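import Summits.SmoothPoincare4.SmoothPoincare4.Theses.SymplecticOrigami
import Summits.SmoothPoincare4.SmoothPoincare4.Theses.SymplecticCap
import Summits.SmoothPoincare4.SmoothPoincare4.Theses.SchoenfliesSplit
import Summits.SmoothPoincare4.SmoothPoincare4.Theorems.OrigamiRung.Negative.RefutationCost
import Summits.SmoothPoincare4.SmoothPoincare4.Theorems.OrigamiRung.Negative.GenusTable
import Literature.Geometry.Symplectic.GromovR4RelEnd
import Literature.Topology.FourManifolds.TwistedSpheres
import Literature.Topology.FourManifolds.CerfGammaFour
import Literature.Topology.FourManifolds.AkbulutKirbyCerfReduction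
import Literature.Topology.FourManifolds.HomotopyS4CompactProofs

/-!
# Line `round-tube-pullback-collar` for the crux `SymplecticOrigami.OrigamiRung` (stmt-SmoothPoincare4-7843)

Skeleton (crux-plan, round 1, planner seat `cruxplan-stmt-SmoothPoincare4-7843-round-tube-pullback-`).
Idea card `Cruxes/OrigamiRung/Ideas/round-tube-pullback-collar.md` (triage r1: pass ×3, "merge with
corank-one-collar"; sharpenings applied, see the line card `Lines/round-tube-pullback-collar.md`).

THE LEVER, made exact (`stub_collar`). Do not push the collar of the fold `Z` forward by the blow-down map
`βᵢ` (that comparison is where Schoenflies / h-cobordism ambiguity lives); pull the ROUND tube back: for ANY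
"round tube function" `q` about the surface `Bᵢ = range bᵢ ⊂ Nᵢ` — locally `q = ‖w‖²` for a submersive
normal coordinate `w` vanishing exactly on `Bᵢ` (fibre norm² of a tubular neighbourhood; or the squared
Fubini–Study distance `|z₀|²/|z|²` to the line, read through a symplectic neighbourhood chart) — the rank count
`rank dβᵢ = 3 = dim T Bᵢ + 1` on `Z` (forced by the corank-ONE clause and `βᵢ(Z) ⊆ Bᵢ`) and Hadamard's lemma
ACROSS `Z` (`βᵢ` is smooth on an open `U ⊇ closure Vᵢ`) give `w ∘ βᵢ = t · u`, `u ≠ 0`, so `q ∘ βᵢ` is the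
square of a signed boundary-defining function of `Z` without critical points; flowing along it yields a Fermi
chart `F : Z × (−ε, ε) → M` with `q (βᵢ (F (p, t))) = t²` on the `Vᵢ`-side: the preimages of the ROUND sphere
bundles `{q = t²}` are the product slices `F(Z × {t})`, whatever the angular behaviour of `βᵢ`.  Consequences
consumed downstream: `Z ≅ S(νBᵢ)` and `V̄ᵢ ≅ Nᵢ ∖ ν̊Bᵢ` (homology of the pieces — `stub_pinch`), and the
bicollar between `∂(Φᵢ⁻¹ closed ball)` and `Z` is a product (twisted-sphere assembly — `stub_genusZeroTwisted`).

THE LINE (= the three-step line found by all three ideators, triage summary "collar → SW-free integral pinch →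
genus-0 endgame", with the collar as its registered front end and the endgame engine E2 = in-tree Gromov rel
end, shared with route SymplecticCap):

* `stub_sides`   — two-sidedness: `frontier Vᵢ = Z` and `Vᵢ` regular-open (each piece on ONE side of `Z`).
* `stub_collar`  — the lever above (one piece, local, any round tube function).
* `stub_pinch`   — integral Mayer–Vietoris / Thom–Gysin / Hantzsche pinch, CONSUMING sides + collar:
                   `b₂(Nᵢ) = 1`, `H₁(Nᵢ ∖ Bᵢ)` torsion-free (`e = m = 1`), `Σ b₁(Nᵢ) = b₁(S₀) = b₁(S₁)` (`= 2g`),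
                   and `b₁(Sᵢ) = 0 ⇒ H₁(Vᵢ) = H₂(Vᵢ) = 0`.
* `stub_chern`   — Chern package on ONE closed symplectic piece with `b₂ = 1` and a symplectic surface whose
                   complement has torsion-free `H₁`: `(3 − b₁(S))² = 9 − 4 b₁(N)` (adjunction + `c₁² = 2χ + 3σ`).
* arithmetic     — PROVED here (`sieve_arith_nat`): only `g = 0` (both `b₁(Nᵢ) = 0`) or `g = 2` (both `= 2`).
* `stub_genusZeroTwisted` — `gromov_recognitionR4_relEnd →` genus-0 data + sides + collar ⇒ `M = D⁴ ∪_φ D⁴`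
                   (`IsTwistedSphere 3 φ M`): Weinstein tube of the `(+1)`-sphere = outer shell of a ball,
                   radial stretch, Gromov rel end on `Vᵢ` itself, `Dᵢ = Φᵢ⁻¹(closed ball)`, collar product.
* `OrigamiRung_of` — sorry-free composition; its only non-stub hypotheses are two TAGGED ITEMS of sibling routes
  whose bodies are verbatim the tree's named facts: `SymplecticCap.GromovRecognitionRelEnd`
  (stmt-SmoothPoincare4-11009 = `Literature.Geometry.Symplectic.gromov_recognitionR4_relEnd`, `Iff.rfl`) and
  `SchoenfliesSplit.SchsplitCerf` (stmt-SmoothPoincare4-8758 = `Literature.Topology.FourManifolds.cerf_twistedSphere_four`,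
  Cerf `Γ₄ = 0`); the door branch `g = 2` is returned as the crux's second disjunct.

Disproof used (`Cruxes/OrigamiRung/Disproof.lean`, cdisprove cycle 1; landed `Negative/RefutationCost`,
`Negative/GenusTable`, both imported below so the scratch check sees them): §1–2 there is NO
`_false_without_<H>` theorem for this crux (`StrongestRung ↔ SmoothPoincare4`: every hypothesis is
load-bearing for the METHOD only) — the method hypotheses are consumed here as follows: corank-1 clause +
`β '' frontier ⊆ range b` + smoothness on `U ⊇ closure V` at `stub_collar`; `M ≃ₕ S⁴` at `stub_sides`
(connectedness), `stub_pinch` (`H₁ = H₂ = 0`) and `stub_genusZeroTwisted` (`π₁ = 1`); the symplectic clauses at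
`stub_pinch` (`e ≠ 0`), `stub_chern`, `stub_genusZeroTwisted` (Weinstein, Gromov).  §3 `door_is_solution`
(tightness) is respected: the door tuple is NOT excluded, it is the right disjunct; `genusTable`/`bettiPinch`
are superseded by `stub_chern` + `sieve_arith_nat` (no Liu Thm A/B, no `K`-sign); `conic_case_excluded` is the
`m = 2` instance of the torsion step inside `stub_pinch`.  §4 `collarLemmaSketch` = the second-order route to
the same boundary-defining function; `mutationNotes` (frontier `Vᵢ = Z` automatic) = `stub_sides`.  No stub is
an instance of a landed Negative lemma (they refute nothing; checked by importing them).
-/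

noncomputable section

-- the prescribed namespace `Summit.<P>.<Sub>.…` duplicates `SmoothPoincare4` (P = Sub)
set_option linter.dupNamespace false

namespace Summit.SmoothPoincare4.SmoothPoincare4.Cruxes.OrigamiRung.RoundTubePullbackCollar

open scoped Manifold ContDiff Topology ContinuousMap

/-! ## §0 Vocabulary of the line (two local predicates; the stubs inline them) -/

/-- **Round tube function** about the surface `range b ⊂ N`: near every point of the surface, `q = ‖w‖²`
for a smooth `ℝ²`-valued normal coordinate `w` vanishing exactly on the surface, submersive there.
Instances: the fibre-norm² of any tubular neighbourhood with a Euclidean structure; the squared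
Fubini–Study distance `|z₀|²/|z|²` to a line in `ℂP²` (hence its transport by a symplectic neighbourhood
chart of a `(+1)`-sphere). -/
def IsRoundTubeFn {N : Type} [TopologicalSpace N] [ChartedSpace (EuclideanSpace ℝ (Fin 4)) N]
    {S : Type} [TopologicalSpace S] [ChartedSpace (EuclideanSpace ℝ (Fin 2)) S]
    (b : S → N) (q : N → ℝ) : Prop :=
  ∀ p : S, ∃ O : Set N, IsOpen O ∧ b p ∈ O ∧ ∃ w : N → EuclideanSpace ℝ (Fin 2),
    ContMDiffOn (𝓡 4) 𝓘(ℝ, EuclideanSpace ℝ (Fin 2)) ∞ w O ∧ (∀ y ∈ O, w y = 0 ↔ y ∈ Set.range b) ∧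
    Function.Surjective (mfderiv (𝓡 4) 𝓘(ℝ, EuclideanSpace ℝ (Fin 2)) w (b p)) ∧ ∀ y ∈ O, q y = ‖w y‖ ^ 2

/-- **Pullback collar** (the lever's output): a Fermi chart `F : Z × (−ε, ε) → M` of the hypersurface
`z : Z → M` — smooth, injective, open image, invertible differential, `F (p, 0) = z p` — whose positive side
is exactly `V` and along which the pulled-back tube function is the ROUND one: `q (β (F (p, t))) = t²` for
`0 ≤ t < ε`.  Hence `F (Z × {t}) = V ∩ β⁻¹ {q = t²}` near `Z` (the preimage of the round sphere bundle is a
product slice), `F (Z × [0, t])` is a product collar of `Z` in `closure V`, and `Z ≅ {q ∘ β = t²}`. -/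
def HasPullbackCollar {M : Type} [TopologicalSpace M] [ChartedSpace (EuclideanSpace ℝ (Fin 4)) M]
    (V : Set M) {N : Type} (β : M → N) (q : N → ℝ)
    {Z : Type} [TopologicalSpace Z] [ChartedSpace (EuclideanSpace ℝ (Fin 3)) Z] (z : Z → M) : Prop :=
  ∃ ε : ℝ, 0 < ε ∧ ∃ F : Z × ℝ → M,
    ContMDiffOn ((𝓡 3).prod 𝓘(ℝ, ℝ)) (𝓡 4) ∞ F (Set.univ ×ˢ Set.Ioo (-ε) ε) ∧
    Set.InjOn F (Set.univ ×ˢ Set.Ioo (-ε) ε) ∧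
    IsOpen (F '' (Set.univ ×ˢ Set.Ioo (-ε) ε)) ∧
    (∀ x : Z × ℝ, x ∈ Set.univ ×ˢ Set.Ioo (-ε) ε →
      Function.Bijective (mfderiv ((𝓡 3).prod 𝓘(ℝ, ℝ)) (𝓡 4) F x)) ∧
    (∀ p : Z, F (p, 0) = z p) ∧
    (∀ (p : Z) (t : ℝ), t ∈ Set.Ioo (-ε) ε → (F (p, t) ∈ V ↔ 0 < t)) ∧
    (∀ (p : Z) (t : ℝ), t ∈ Set.Ico 0 ε → q (β (F (p, t))) = t ^ 2)


/-! ## §1 The five stub STATEMENTS, named (readable form over the §0 vocabulary; the registered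
`stub_*` theorems of §2 restate them with every local definition inlined, `Registered.stub_*` (§3) are the
name-keyed aliases used as the hypotheses of `OrigamiRung_of`, and the `example` after it certifies that each
inlined restatement is definitionally the named statement) -/

/-- Statement of STUB 1 (`stub_sides`): the fold is the common frontier of both pieces and each piece is
regular-open (lies on ONE side of `Z`). -/
def SidesStatement : Prop :=
    ∀ (M : Type) [TopologicalSpace M] [T2Space M] [SecondCountableTopology M] [ChartedSpace
      (EuclideanSpace ℝ (Fin 4)) M] [IsManifold (𝓡 4) ∞ M], M ≃ₕ Metric.sphere (0 : EuclideanSpace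
      ℝ (Fin 5)) 1 → ∀ (V : Fin 2 → TopologicalSpace.Opens M) (Z : Type) [TopologicalSpace Z]
      [ChartedSpace (EuclideanSpace ℝ (Fin 3)) Z] [IsManifold (𝓡 3) ∞ Z] (z : Z → M), Disjoint (V
      0) (V 1) → (∀ i, (V i : Set M).Nonempty) → IsConnected ((V 0 : Set M) ∪ (V 1 : Set M))ᶜ →
      Manifold.IsSmoothEmbedding (𝓡 3) (𝓡 4) ∞ z → Set.range z = ((V 0 : Set M) ∪ (V 1 : Set M))ᶜ →
      ∀ i, frontier (V i : Set M) = Set.range z ∧ interior (closure (V i : Set M)) = (V i : Set M)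

/-- Statement of STUB 2 (`stub_collar`) — THE LEVER (round-tube pullback): for one piece, every round tube
function `q` about the surface pulls back under the blow-down map to the square of a Fermi coordinate of the
fold. -/
def CollarStatement : Prop :=
    ∀ (M : Type) [TopologicalSpace M] [T2Space M] [SecondCountableTopology M] [ChartedSpace
      (EuclideanSpace ℝ (Fin 4)) M] [IsManifold (𝓡 4) ∞ M] [CompactSpace M] (V :
      TopologicalSpace.Opens M) (N : Type) [TopologicalSpace N] [T2Space N]
      [SecondCountableTopology N] [ChartedSpace (EuclideanSpace ℝ (Fin 4)) N] [IsManifold (𝓡 4) ∞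
      N] (S : Type) [TopologicalSpace S] [ChartedSpace (EuclideanSpace ℝ (Fin 2)) S] [IsManifold (𝓡
      2) ∞ S] (b : S → N) (β : M → N) (q : N → ℝ) (Z : Type) [TopologicalSpace Z] [ChartedSpace
      (EuclideanSpace ℝ (Fin 3)) Z] [IsManifold (𝓡 3) ∞ Z] (z : Z → M), Manifold.IsSmoothEmbedding
      (𝓡 3) (𝓡 4) ∞ z → Set.range z = frontier (V : Set M) → interior (closure (V : Set M)) = (V :
      Set M) → Manifold.IsSmoothEmbedding (𝓡 2) (𝓡 4) ∞ b → (∃ U : Set M, IsOpen U ∧ closure (V :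
      Set M) ⊆ U ∧ ContMDiffOn (𝓡 4) (𝓡 4) ∞ β U) → β '' frontier (V : Set M) ⊆ Set.range b → (∀ x
      ∈ frontier (V : Set M), Module.finrank ℝ (LinearMap.ker (mfderiv (𝓡 4) (𝓡 4) β
      x).toLinearMap) = 1) → IsRoundTubeFn b q → HasPullbackCollar (V : Set M) β q z

/-- Statement of STUB 3 (`stub_pinch`): the integral Mayer–Vietoris/Thom–Gysin pinch of the two pieces of a
folded homotopy 4-sphere, CONSUMING the sides and collar outputs. -/
def PinchStatement : Prop :=
    ∀ (M : Type) [TopologicalSpace M] [T2Space M] [SecondCountableTopology M] [ChartedSpace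
      (EuclideanSpace ℝ (Fin 4)) M] [IsManifold (𝓡 4) ∞ M], M ≃ₕ Metric.sphere (0 : EuclideanSpace
      ℝ (Fin 5)) 1 → ∀ (V : Fin 2 → TopologicalSpace.Opens M) (N : Fin 2 → Type) [∀ i,
      TopologicalSpace (N i)] [∀ i, T2Space (N i)] [∀ i, SecondCountableTopology (N i)] [∀ i,
      CompactSpace (N i)] [∀ i, ConnectedSpace (N i)] [∀ i, ChartedSpace (EuclideanSpace ℝ (Fin 4))
      (N i)] [∀ i, IsManifold (𝓡 4) ∞ (N i)] (s : ∀ i, Literature.Geometry.Kaehler.MForm (𝓡 4) (N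
      i) ℝ 2) (S : Fin 2 → Type) [∀ i, TopologicalSpace (S i)] [∀ i, CompactSpace (S i)] [∀ i,
      ConnectedSpace (S i)] [∀ i, ChartedSpace (EuclideanSpace ℝ (Fin 2)) (S i)] [∀ i, IsManifold
      (𝓡 2) ∞ (S i)] (b : ∀ i, S i → N i) (β : ∀ i, M → N i) (Z : Type) [TopologicalSpace Z]
      [ChartedSpace (EuclideanSpace ℝ (Fin 3)) Z] [IsManifold (𝓡 3) ∞ Z] (z : Z → M), Disjoint (V
      0) (V 1) → (∀ i, (V i : Set M).Nonempty) → IsConnected ((V 0 : Set M) ∪ (V 1 : Set M))ᶜ →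
      Manifold.IsSmoothEmbedding (𝓡 3) (𝓡 4) ∞ z → Set.range z = ((V 0 : Set M) ∪ (V 1 : Set M))ᶜ →
      (∀ i, Literature.Geometry.Kaehler.IsSmoothForm (s i) ∧
      Literature.Geometry.Kaehler.IsClosedForm (s i) ∧ (∀ x (v : TangentSpace (𝓡 4) x), v ≠ 0 → ∃
      w, s i x ![v, w] ≠ 0) ∧ Manifold.IsSmoothEmbedding (𝓡 2) (𝓡 4) ∞ (b i) ∧ (∀ y (v :
      TangentSpace (𝓡 2) y), v ≠ 0 → ∃ w : TangentSpace (𝓡 2) y, s i (b i y) ![mfderiv (𝓡 2) (𝓡 4)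
      (b i) y v, mfderiv (𝓡 2) (𝓡 4) (b i) y w] ≠ 0) ∧ (∃ U : Set M, IsOpen U ∧ closure (V i : Set
      M) ⊆ U ∧ ContMDiffOn (𝓡 4) (𝓡 4) ∞ (β i) U) ∧ Set.InjOn (β i) (V i : Set M) ∧ β i '' (V i :
      Set M) = (Set.range (b i))ᶜ ∧ (∀ x ∈ (V i : Set M), Function.Bijective (mfderiv (𝓡 4) (𝓡 4)
      (β i) x)) ∧ β i '' frontier (V i : Set M) ⊆ Set.range (b i) ∧ (∀ x ∈ frontier (V i : Set M),
      Module.finrank ℝ (LinearMap.ker (mfderiv (𝓡 4) (𝓡 4) (β i) x).toLinearMap) = 1)) → (∀ i,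
      frontier (V i : Set M) = Set.range z ∧ interior (closure (V i : Set M)) = (V i : Set M)) → (∀
      (i : Fin 2) (q : N i → ℝ), IsRoundTubeFn (b i) q → HasPullbackCollar (V i : Set M) (β i) q z)
      → (∀ i, Module.finrank ℤ (Literature.Topology.FourManifolds.singularHomologyZ (N i) 2) = 1 ∧
      NoZeroSMulDivisors ℤ (Literature.Topology.FourManifolds.singularHomologyZ (↥((Set.range (b
      i))ᶜ)) 1) ∧ (Module.finrank ℤ (Literature.Topology.FourManifolds.singularHomologyZ (S i) 1) =
      0 → Subsingleton (Literature.Topology.FourManifolds.singularHomologyZ (V i) 1) ∧ Subsingleton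
      (Literature.Topology.FourManifolds.singularHomologyZ (V i) 2))) ∧ Module.finrank ℤ
      (Literature.Topology.FourManifolds.singularHomologyZ (N 0) 1) + Module.finrank ℤ
      (Literature.Topology.FourManifolds.singularHomologyZ (N 1) 1) = Module.finrank ℤ
      (Literature.Topology.FourManifolds.singularHomologyZ (S 0) 1) ∧ Module.finrank ℤ
      (Literature.Topology.FourManifolds.singularHomologyZ (S 0) 1) = Module.finrank ℤ
      (Literature.Topology.FourManifolds.singularHomologyZ (S 1) 1)

/-- Statement of STUB 4 (`stub_chern`): the Chern-number package on one closed symplectic piece. -/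
def ChernStatement : Prop :=
    ∀ (N : Type) [TopologicalSpace N] [T2Space N] [SecondCountableTopology N] [CompactSpace N]
      [ConnectedSpace N] [ChartedSpace (EuclideanSpace ℝ (Fin 4)) N] [IsManifold (𝓡 4) ∞ N] (s :
      Literature.Geometry.Kaehler.MForm (𝓡 4) N ℝ 2) (S : Type) [TopologicalSpace S] [CompactSpace
      S] [ConnectedSpace S] [ChartedSpace (EuclideanSpace ℝ (Fin 2)) S] [IsManifold (𝓡 2) ∞ S] (b :
      S → N), Literature.Geometry.Kaehler.IsSmoothForm s → Literature.Geometry.Kaehler.IsClosedForm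
      s → (∀ x (v : TangentSpace (𝓡 4) x), v ≠ 0 → ∃ w, s x ![v, w] ≠ 0) →
      Manifold.IsSmoothEmbedding (𝓡 2) (𝓡 4) ∞ b → (∀ y (v : TangentSpace (𝓡 2) y), v ≠ 0 → ∃ w :
      TangentSpace (𝓡 2) y, s (b y) ![mfderiv (𝓡 2) (𝓡 4) b y v, mfderiv (𝓡 2) (𝓡 4) b y w] ≠ 0) →
      Module.finrank ℤ (Literature.Topology.FourManifolds.singularHomologyZ N 2) = 1 →
      NoZeroSMulDivisors ℤ (Literature.Topology.FourManifolds.singularHomologyZ (↥((Set.range b)ᶜ))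
      1) → ((3 : ℤ) - (Module.finrank ℤ (Literature.Topology.FourManifolds.singularHomologyZ S 1) :
      ℤ)) ^ 2 = 9 - 4 * (Module.finrank ℤ (Literature.Topology.FourManifolds.singularHomologyZ N 1)
      : ℤ)

/-- Statement of STUB 5 (`stub_genusZeroTwisted`): the genus-zero endgame under Gromov's recognition of
`ℝ⁴` relative at infinity, CONSUMING the sides and collar outputs. -/
def GenusZeroTwistedStatement : Prop :=
    ∀ (M : Type) [TopologicalSpace M] [T2Space M] [SecondCountableTopology M] [ChartedSpace
      (EuclideanSpace ℝ (Fin 4)) M] [IsManifold (𝓡 4) ∞ M], M ≃ₕ Metric.sphere (0 : EuclideanSpace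
      ℝ (Fin 5)) 1 → ∀ (V : Fin 2 → TopologicalSpace.Opens M) (N : Fin 2 → Type) [∀ i,
      TopologicalSpace (N i)] [∀ i, T2Space (N i)] [∀ i, SecondCountableTopology (N i)] [∀ i,
      CompactSpace (N i)] [∀ i, ConnectedSpace (N i)] [∀ i, ChartedSpace (EuclideanSpace ℝ (Fin 4))
      (N i)] [∀ i, IsManifold (𝓡 4) ∞ (N i)] (s : ∀ i, Literature.Geometry.Kaehler.MForm (𝓡 4) (N
      i) ℝ 2) (S : Fin 2 → Type) [∀ i, TopologicalSpace (S i)] [∀ i, CompactSpace (S i)] [∀ i,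
      ConnectedSpace (S i)] [∀ i, ChartedSpace (EuclideanSpace ℝ (Fin 2)) (S i)] [∀ i, IsManifold
      (𝓡 2) ∞ (S i)] (b : ∀ i, S i → N i) (β : ∀ i, M → N i) (Z : Type) [TopologicalSpace Z]
      [ChartedSpace (EuclideanSpace ℝ (Fin 3)) Z] [IsManifold (𝓡 3) ∞ Z] (z : Z → M), Disjoint (V
      0) (V 1) → (∀ i, (V i : Set M).Nonempty) → IsConnected ((V 0 : Set M) ∪ (V 1 : Set M))ᶜ →
      Manifold.IsSmoothEmbedding (𝓡 3) (𝓡 4) ∞ z → Set.range z = ((V 0 : Set M) ∪ (V 1 : Set M))ᶜ →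
      (∀ i, Literature.Geometry.Kaehler.IsSmoothForm (s i) ∧
      Literature.Geometry.Kaehler.IsClosedForm (s i) ∧ (∀ x (v : TangentSpace (𝓡 4) x), v ≠ 0 → ∃
      w, s i x ![v, w] ≠ 0) ∧ Manifold.IsSmoothEmbedding (𝓡 2) (𝓡 4) ∞ (b i) ∧ (∀ y (v :
      TangentSpace (𝓡 2) y), v ≠ 0 → ∃ w : TangentSpace (𝓡 2) y, s i (b i y) ![mfderiv (𝓡 2) (𝓡 4)
      (b i) y v, mfderiv (𝓡 2) (𝓡 4) (b i) y w] ≠ 0) ∧ (∃ U : Set M, IsOpen U ∧ closure (V i : Set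
      M) ⊆ U ∧ ContMDiffOn (𝓡 4) (𝓡 4) ∞ (β i) U) ∧ Set.InjOn (β i) (V i : Set M) ∧ β i '' (V i :
      Set M) = (Set.range (b i))ᶜ ∧ (∀ x ∈ (V i : Set M), Function.Bijective (mfderiv (𝓡 4) (𝓡 4)
      (β i) x)) ∧ β i '' frontier (V i : Set M) ⊆ Set.range (b i) ∧ (∀ x ∈ frontier (V i : Set M),
      Module.finrank ℝ (LinearMap.ker (mfderiv (𝓡 4) (𝓡 4) (β i) x).toLinearMap) = 1)) → (∀ i,
      frontier (V i : Set M) = Set.range z ∧ interior (closure (V i : Set M)) = (V i : Set M)) → (∀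
      (i : Fin 2) (q : N i → ℝ), IsRoundTubeFn (b i) q → HasPullbackCollar (V i : Set M) (β i) q z)
      → (∀ i, Module.finrank ℤ (Literature.Topology.FourManifolds.singularHomologyZ (S i) 1) = 0 ∧
      Module.finrank ℤ (Literature.Topology.FourManifolds.singularHomologyZ (N i) 2) = 1 ∧
      NoZeroSMulDivisors ℤ (Literature.Topology.FourManifolds.singularHomologyZ (↥((Set.range (b
      i))ᶜ)) 1) ∧ Subsingleton (Literature.Topology.FourManifolds.singularHomologyZ (V i) 1) ∧
      Subsingleton (Literature.Topology.FourManifolds.singularHomologyZ (V i) 2)) →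
      Literature.Geometry.Symplectic.gromov_recognitionR4_relEnd → ∃ φ : (Metric.sphere (0 :
      EuclideanSpace ℝ (Fin 4)) 1) ≃ₘ⟮𝓡 3, 𝓡 3⟯ (Metric.sphere (0 : EuclideanSpace ℝ (Fin 4)) 1),
      Literature.Topology.FourManifolds.IsTwistedSphere 3 φ M

/-! ## §2 The registered stubs (`sorry` lives ONLY in these five theorems; signatures fully inlined over
Mathlib + Literature + the route file, so that a stub worker can restate them verbatim in a Theorems file) -/

/-- **STUB 1 · `stub_sides`** (PROVABLE NOW; size M; point-set / differential topology of a
codimension-one embedding).  For the fold data of the crux — `V 0, V 1` disjoint non-empty open sets of the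
homotopy 4-sphere `M` whose complement is connected and is the image of the smooth embedding `z : Z → M` of a
3-manifold — BOTH pieces have frontier exactly `Z = range z`, and each is regular-open
(`interior (closure Vᵢ) = Vᵢ`, i.e. at every fold point the two local sides of the slice chart lie in
DIFFERENT pieces).  Proof route: slice charts from `Manifold.IsSmoothEmbedding` (`IsImmersion` charts +
topological embedding) give two connected local sides at each `z ∈ Z`; `Vᵢ` is clopen in `M ∖ Z`, so each
side lies in one piece; `{z | V₀ adherent at z}` is clopen in the connected `Z` and non-empty because `M`
(`≃ₕ S⁴`) is connected and `V₀` is not clopen; both sides in `V₀` would contradict adherence of `V₁`.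
(= Disproof §4 `mutationNotes`, triage (S) of corank-one-collar.)  Why a stub and not glue: it is the input
of THREE stubs (collar: one-sidedness; pinch: `closure Vᵢ = Vᵢ ∪ Z`; endgame: `M = V₀ ⊔ Z ⊔ V₁`).
[folklore] -/
theorem stub_sides :
    ∀ (M : Type) [TopologicalSpace M] [T2Space M] [SecondCountableTopology M] [ChartedSpace
      (EuclideanSpace ℝ (Fin 4)) M] [IsManifold (𝓡 4) ∞ M], M ≃ₕ Metric.sphere (0 : EuclideanSpace
      ℝ (Fin 5)) 1 → ∀ (V : Fin 2 → TopologicalSpace.Opens M) (Z : Type) [TopologicalSpace Z]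
      [ChartedSpace (EuclideanSpace ℝ (Fin 3)) Z] [IsManifold (𝓡 3) ∞ Z] (z : Z → M), Disjoint (V
      0) (V 1) → (∀ i, (V i : Set M).Nonempty) → IsConnected ((V 0 : Set M) ∪ (V 1 : Set M))ᶜ →
      Manifold.IsSmoothEmbedding (𝓡 3) (𝓡 4) ∞ z → Set.range z = ((V 0 : Set M) ∪ (V 1 : Set M))ᶜ →
      ∀ i, frontier (V i : Set M) = Set.range z ∧ interior (closure (V i : Set M)) = (V i : Set M) := by
  sorry

/-- **STUB 2 · `stub_collar` — THE LEVER: ROUND-TUBE PULLBACK** (PROVABLE NOW; size L; local differential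
topology, no symplectic input, no homotopy-sphere input).  One piece: `V ⊆ M` open and regular-open with
frontier the compact embedded hypersurface `z : Z → M`; `b : S → N` an embedded surface; `β : M → N` smooth on
an open `U ⊇ closure V`, `β (frontier V) ⊆ range b`, `dim ker dβ = 1` on the frontier; `q` a ROUND TUBE
FUNCTION about `range b` (locally `q = ‖w‖²`, `w` a submersive normal coordinate vanishing exactly on the
surface).  Conclusion: a Fermi chart `F : Z × (−ε, ε) → M` (smooth, injective, open image, invertible
differential, `F (p, 0) = z p`) with `F (p, t) ∈ V ↔ 0 < t` and `q (β (F (p, t))) = t²` for `0 ≤ t < ε`.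
Proof route (card + triage): (R1) `β ∘ z` factors smoothly through the embedding `b`, so `dβ (T Z) ⊆ T B`;
(R2) the 1-dimensional kernel lies in `T Z`, hence (R3) `dβ (ν) ∉ T B = ker dw` for a transversal `ν`
(rank `3 = 2 + 1`); Hadamard across `Z` in a slice chart `(y, τ)`: `w ∘ β = τ · u`, `u(y, 0) ≠ 0`, so
`q ∘ β = τ² ‖u‖²` and `σ := τ ‖u‖ = ±√(q ∘ β)` (sign by side: regular-openness) is smooth near `Z` with
`dσ ≠ 0` on `Z`; flow a vector field `X` with `dσ (X) = 1` from `z` (uniform time by compactness of `Z`,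
closed in the compact `M`) to get `F` with `σ ∘ F = t`.  NOTE: no claim about the angular part of the
normal jet and NO "β̃ : closure V ≅ Bl_B N" (false as typed — torus-meridian-pinch's counter-model); the
dropped CdGP property (4) is not needed.  Honours the method-hypotheses the Disproof marks load-bearing
(corank 1, `β '' frontier ⊆ range b`, smoothness ACROSS `Z`).  Leans on: Mathlib `Manifold.IsSmoothEmbedding`,
`ContMDiffOn`, `mfderiv`, rank–nullity, `Real.sqrt` smooth off `0`, integral curves
(`Mathlib.Geometry.Manifold.IntegralCurve`); tree: `Literature.Geometry.Riemannian.exists_tubularChart_normalExp`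
(Fermi chart of a compact hypersurface with a transverse field), `Literature/Topology/FourManifolds/`
`CollarTheorem`, `BoundaryFlowout`, `RegularSlabField`, `GradientCollarField` (flow-outs along a field with
`X(f) = 1`). [folklore] -/
theorem stub_collar :
    ∀ (M : Type) [TopologicalSpace M] [T2Space M] [SecondCountableTopology M] [ChartedSpace
      (EuclideanSpace ℝ (Fin 4)) M] [IsManifold (𝓡 4) ∞ M] [CompactSpace M] (V :
      TopologicalSpace.Opens M) (N : Type) [TopologicalSpace N] [T2Space N]
      [SecondCountableTopology N] [ChartedSpace (EuclideanSpace ℝ (Fin 4)) N] [IsManifold (𝓡 4) ∞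
      N] (S : Type) [TopologicalSpace S] [ChartedSpace (EuclideanSpace ℝ (Fin 2)) S] [IsManifold (𝓡
      2) ∞ S] (b : S → N) (β : M → N) (q : N → ℝ) (Z : Type) [TopologicalSpace Z] [ChartedSpace
      (EuclideanSpace ℝ (Fin 3)) Z] [IsManifold (𝓡 3) ∞ Z] (z : Z → M), Manifold.IsSmoothEmbedding
      (𝓡 3) (𝓡 4) ∞ z → Set.range z = frontier (V : Set M) → interior (closure (V : Set M)) = (V :
      Set M) → Manifold.IsSmoothEmbedding (𝓡 2) (𝓡 4) ∞ b → (∃ U : Set M, IsOpen U ∧ closure (V :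
      Set M) ⊆ U ∧ ContMDiffOn (𝓡 4) (𝓡 4) ∞ β U) → β '' frontier (V : Set M) ⊆ Set.range b → (∀ x
      ∈ frontier (V : Set M), Module.finrank ℝ (LinearMap.ker (mfderiv (𝓡 4) (𝓡 4) β
      x).toLinearMap) = 1) → (∀ p : S, ∃ O : Set N, IsOpen O ∧ b p ∈ O ∧ ∃ w : N → EuclideanSpace ℝ
      (Fin 2), ContMDiffOn (𝓡 4) 𝓘(ℝ, EuclideanSpace ℝ (Fin 2)) ∞ w O ∧ (∀ y ∈ O, w y = 0 ↔ y ∈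
      Set.range b) ∧ Function.Surjective (mfderiv (𝓡 4) 𝓘(ℝ, EuclideanSpace ℝ (Fin 2)) w (b p)) ∧ ∀
      y ∈ O, q y = ‖w y‖ ^ 2) → ∃ ε : ℝ, 0 < ε ∧ ∃ F : Z × ℝ → M, ContMDiffOn ((𝓡 3).prod 𝓘(ℝ, ℝ))
      (𝓡 4) ∞ F (Set.univ ×ˢ Set.Ioo (-ε) ε) ∧ Set.InjOn F (Set.univ ×ˢ Set.Ioo (-ε) ε) ∧ IsOpen (F
      '' (Set.univ ×ˢ Set.Ioo (-ε) ε)) ∧ (∀ x : Z × ℝ, x ∈ Set.univ ×ˢ Set.Ioo (-ε) ε →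
      Function.Bijective (mfderiv ((𝓡 3).prod 𝓘(ℝ, ℝ)) (𝓡 4) F x)) ∧ (∀ p : Z, F (p, 0) = z p) ∧ (∀
      (p : Z) (t : ℝ), t ∈ Set.Ioo (-ε) ε → (F (p, t) ∈ (V : Set M) ↔ 0 < t)) ∧ (∀ (p : Z) (t : ℝ),
      t ∈ Set.Ico 0 ε → q (β (F (p, t))) = t ^ 2) := by
  sorry

/-- **STUB 3 · `stub_pinch` — SW-FREE INTEGRAL PINCH** (TRUE classically; size XL as a formal task: Mayer–Vietoris,
Thom/Gysin and Alexander–Lefschetz duality for Mathlib's singular homology are only partly in the tree;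
mathematically the merged card rank-one-integrality-pinch ≈ torus-meridian-pinch ≈ adjunction-doubling-sieve,
triage pass ×3).  Hypotheses: the crux data VERBATIM (fold `z : Z → M` made explicit) + the outputs of
`stub_sides` and `stub_collar` (for every piece and every round tube function).  Conclusion (genus-agnostic,
true in BOTH branches): `b₂(Nᵢ) = 1`; `H₁(Nᵢ ∖ Bᵢ; ℤ)` torsion-free (encodes `e = m = 1`: the meridian
`ℤ/m ↪ H₁(N ∖ B)` and Hantzsche's `Tors H₁(Z) ≅ T ⊕ T` cyclic); `b₁(N₀) + b₁(N₁) = b₁(S₀) = b₁(S₁)` (`= 2g`);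
and `b₁(Sᵢ) = 0 ⇒ H₁(Vᵢ) = H₂(Vᵢ) = 0` (`Z ≅ S³` when `g = 0`, `e = 1`).  Proof route: apply the collar to
the fibre-norm² `q` of a tubular neighbourhood of `Bᵢ` (a round tube function) — its Fermi chart identifies
`Z` with `βᵢ⁻¹ S_t(νBᵢ) ≅ S_t(νBᵢ)` and `Vᵢ ∪ F(Z × (−ε, ε))` deformation-retracts to `Vᵢ ≅ Nᵢ ∖ Bᵢ`
(through `βᵢ|Vᵢ`, a diffeomorphism onto the complement); integral MV in the homology sphere `M`
(`H̃ₖ(Z) ≅ H̃ₖ(V₀) ⊕ H̃ₖ(V₁)`), Gysin/Thom for `(Nᵢ, Bᵢ)` (fibred tori bound ⇒ `H₂(Nᵢ) ↪ H₀(Bᵢ) = ℤ`),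
`[Bᵢ] ≠ 0` rationally (symplectic: `∫ω > 0`) ⇒ `e ≠ 0` (the `e = 0` branch dies on the almost-complex parity,
Disproof `no_isotropic_pinch`), torsion step ⇒ `|e| = 1` (small models `conic_case_excluded`, triage
`no_double_in_cyclic`).  Leans on: tree `singularHomologyZ`, `Literature/AlgebraicTopology/SingularHomology/*`
(Mayer–Vietoris pieces), `isZero_singularHomologyZ_two_of_homotopyEquiv`; NOT in tree: Thom/Gysin for a
codimension-2 submanifold, homology of circle bundles over surfaces, de Rham pairing (cite facts to state inline).
[folklore] -/
theorem stub_pinch :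
    ∀ (M : Type) [TopologicalSpace M] [T2Space M] [SecondCountableTopology M] [ChartedSpace
      (EuclideanSpace ℝ (Fin 4)) M] [IsManifold (𝓡 4) ∞ M], M ≃ₕ Metric.sphere (0 : EuclideanSpace
      ℝ (Fin 5)) 1 → ∀ (V : Fin 2 → TopologicalSpace.Opens M) (N : Fin 2 → Type) [∀ i,
      TopologicalSpace (N i)] [∀ i, T2Space (N i)] [∀ i, SecondCountableTopology (N i)] [∀ i,
      CompactSpace (N i)] [∀ i, ConnectedSpace (N i)] [∀ i, ChartedSpace (EuclideanSpace ℝ (Fin 4))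
      (N i)] [∀ i, IsManifold (𝓡 4) ∞ (N i)] (s : ∀ i, Literature.Geometry.Kaehler.MForm (𝓡 4) (N
      i) ℝ 2) (S : Fin 2 → Type) [∀ i, TopologicalSpace (S i)] [∀ i, CompactSpace (S i)] [∀ i,
      ConnectedSpace (S i)] [∀ i, ChartedSpace (EuclideanSpace ℝ (Fin 2)) (S i)] [∀ i, IsManifold
      (𝓡 2) ∞ (S i)] (b : ∀ i, S i → N i) (β : ∀ i, M → N i) (Z : Type) [TopologicalSpace Z]
      [ChartedSpace (EuclideanSpace ℝ (Fin 3)) Z] [IsManifold (𝓡 3) ∞ Z] (z : Z → M), Disjoint (V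
      0) (V 1) → (∀ i, (V i : Set M).Nonempty) → IsConnected ((V 0 : Set M) ∪ (V 1 : Set M))ᶜ →
      Manifold.IsSmoothEmbedding (𝓡 3) (𝓡 4) ∞ z → Set.range z = ((V 0 : Set M) ∪ (V 1 : Set M))ᶜ →
      (∀ i, Literature.Geometry.Kaehler.IsSmoothForm (s i) ∧
      Literature.Geometry.Kaehler.IsClosedForm (s i) ∧ (∀ x (v : TangentSpace (𝓡 4) x), v ≠ 0 → ∃
      w, s i x ![v, w] ≠ 0) ∧ Manifold.IsSmoothEmbedding (𝓡 2) (𝓡 4) ∞ (b i) ∧ (∀ y (v :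
      TangentSpace (𝓡 2) y), v ≠ 0 → ∃ w : TangentSpace (𝓡 2) y, s i (b i y) ![mfderiv (𝓡 2) (𝓡 4)
      (b i) y v, mfderiv (𝓡 2) (𝓡 4) (b i) y w] ≠ 0) ∧ (∃ U : Set M, IsOpen U ∧ closure (V i : Set
      M) ⊆ U ∧ ContMDiffOn (𝓡 4) (𝓡 4) ∞ (β i) U) ∧ Set.InjOn (β i) (V i : Set M) ∧ β i '' (V i :
      Set M) = (Set.range (b i))ᶜ ∧ (∀ x ∈ (V i : Set M), Function.Bijective (mfderiv (𝓡 4) (𝓡 4)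
      (β i) x)) ∧ β i '' frontier (V i : Set M) ⊆ Set.range (b i) ∧ (∀ x ∈ frontier (V i : Set M),
      Module.finrank ℝ (LinearMap.ker (mfderiv (𝓡 4) (𝓡 4) (β i) x).toLinearMap) = 1)) → (∀ i,
      frontier (V i : Set M) = Set.range z ∧ interior (closure (V i : Set M)) = (V i : Set M)) → (∀
      (i : Fin 2) (q : N i → ℝ), (∀ p : S i, ∃ O : Set (N i), IsOpen O ∧ b i p ∈ O ∧ ∃ w : N i →
      EuclideanSpace ℝ (Fin 2), ContMDiffOn (𝓡 4) 𝓘(ℝ, EuclideanSpace ℝ (Fin 2)) ∞ w O ∧ (∀ y ∈ O,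
      w y = 0 ↔ y ∈ Set.range (b i)) ∧ Function.Surjective (mfderiv (𝓡 4) 𝓘(ℝ, EuclideanSpace ℝ
      (Fin 2)) w (b i p)) ∧ ∀ y ∈ O, q y = ‖w y‖ ^ 2) → ∃ ε : ℝ, 0 < ε ∧ ∃ F : Z × ℝ → M,
      ContMDiffOn ((𝓡 3).prod 𝓘(ℝ, ℝ)) (𝓡 4) ∞ F (Set.univ ×ˢ Set.Ioo (-ε) ε) ∧ Set.InjOn F
      (Set.univ ×ˢ Set.Ioo (-ε) ε) ∧ IsOpen (F '' (Set.univ ×ˢ Set.Ioo (-ε) ε)) ∧ (∀ x : Z × ℝ, x ∈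
      Set.univ ×ˢ Set.Ioo (-ε) ε → Function.Bijective (mfderiv ((𝓡 3).prod 𝓘(ℝ, ℝ)) (𝓡 4) F x)) ∧
      (∀ p : Z, F (p, 0) = z p) ∧ (∀ (p : Z) (t : ℝ), t ∈ Set.Ioo (-ε) ε → (F (p, t) ∈ (V i : Set
      M) ↔ 0 < t)) ∧ (∀ (p : Z) (t : ℝ), t ∈ Set.Ico 0 ε → q (β i (F (p, t))) = t ^ 2)) → (∀ i,
      Module.finrank ℤ (Literature.Topology.FourManifolds.singularHomologyZ (N i) 2) = 1 ∧
      NoZeroSMulDivisors ℤ (Literature.Topology.FourManifolds.singularHomologyZ (↥((Set.range (b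
      i))ᶜ)) 1) ∧ (Module.finrank ℤ (Literature.Topology.FourManifolds.singularHomologyZ (S i) 1) =
      0 → Subsingleton (Literature.Topology.FourManifolds.singularHomologyZ (V i) 1) ∧ Subsingleton
      (Literature.Topology.FourManifolds.singularHomologyZ (V i) 2))) ∧ Module.finrank ℤ
      (Literature.Topology.FourManifolds.singularHomologyZ (N 0) 1) + Module.finrank ℤ
      (Literature.Topology.FourManifolds.singularHomologyZ (N 1) 1) = Module.finrank ℤ
      (Literature.Topology.FourManifolds.singularHomologyZ (S 0) 1) ∧ Module.finrank ℤ
      (Literature.Topology.FourManifolds.singularHomologyZ (S 0) 1) = Module.finrank ℤ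
      (Literature.Topology.FourManifolds.singularHomologyZ (S 1) 1) := by
  sorry

/-- **STUB 4 · `stub_chern` — THE CHERN PACKAGE ON ONE PIECE** (TRUE classically; size L–XL formally: `c₁` of a
symplectic 4-manifold, the adjunction formula and `c₁² = 2χ + 3σ` are not in the tree — state them inline as
cite facts, MS2017 (4.1.7) p.161 and (4.4.5) p.185, verified on the held copy by triage).  For ONE closed
connected symplectic 4-manifold `(N, s)` (crux clauses) with `b₂(N) = 1`, and a symplectically embedded closed
connected surface `b : S → N` whose complement has torsion-free `H₁`:
`(3 − b₁(S))² = 9 − 4·b₁(N)`.  Proof route: `S` is oriented by `b*s`, so `b₁(S) = 2g`; `[B] ≠ 0` (area) and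
`b₂ = 1` give `b⁺ = 1`, `b⁻ = 0`, form `⟨+1⟩` on `H₂/Tors = ℤh`; the meridian `ℤ/m ↪ H₁(N ∖ B)` is
torsion, so `m = 1`, `[B] = ±h`, `B·B = 1`; adjunction `2g − 2 = B·B − c₁·B = 1 ∓ c` with `c₁ ≡ c h`, and
`c² = c₁² = 2χ + 3σ = 2(3 − 2b₁) + 3 = 9 − 4b₁`.  Consequences used by the glue: `g = 0 ⇒ b₁(N) = 0`
(homology `(ℂP², line)`), `g = 2 ⇒ b₁(N) = 2` (door), `g = 1, g ≥ 3` impossible — `sieve_arith_nat`.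
No Seiberg–Witten, no Liu/Taubes (triage: "bᵢ ∈ {0,2} is free"). [folklore] -/
theorem stub_chern :
    ∀ (N : Type) [TopologicalSpace N] [T2Space N] [SecondCountableTopology N] [CompactSpace N]
      [ConnectedSpace N] [ChartedSpace (EuclideanSpace ℝ (Fin 4)) N] [IsManifold (𝓡 4) ∞ N] (s :
      Literature.Geometry.Kaehler.MForm (𝓡 4) N ℝ 2) (S : Type) [TopologicalSpace S] [CompactSpace
      S] [ConnectedSpace S] [ChartedSpace (EuclideanSpace ℝ (Fin 2)) S] [IsManifold (𝓡 2) ∞ S] (b :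
      S → N), Literature.Geometry.Kaehler.IsSmoothForm s → Literature.Geometry.Kaehler.IsClosedForm
      s → (∀ x (v : TangentSpace (𝓡 4) x), v ≠ 0 → ∃ w, s x ![v, w] ≠ 0) →
      Manifold.IsSmoothEmbedding (𝓡 2) (𝓡 4) ∞ b → (∀ y (v : TangentSpace (𝓡 2) y), v ≠ 0 → ∃ w :
      TangentSpace (𝓡 2) y, s (b y) ![mfderiv (𝓡 2) (𝓡 4) b y v, mfderiv (𝓡 2) (𝓡 4) b y w] ≠ 0) →
      Module.finrank ℤ (Literature.Topology.FourManifolds.singularHomologyZ N 2) = 1 →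
      NoZeroSMulDivisors ℤ (Literature.Topology.FourManifolds.singularHomologyZ (↥((Set.range b)ᶜ))
      1) → ((3 : ℤ) - (Module.finrank ℤ (Literature.Topology.FourManifolds.singularHomologyZ S 1) :
      ℤ)) ^ 2 = 9 - 4 * (Module.finrank ℤ (Literature.Topology.FourManifolds.singularHomologyZ N 1)
      : ℤ) := by
  sorry

/-- **STUB 5 · `stub_genusZeroTwisted` — THE GENUS-ZERO ENDGAME** (HARDEST; size XL; CONDITIONAL in form: its
first hypothesis after the data is the tree's named fact `Literature.Geometry.Symplectic.gromov_recognitionR4_relEnd`,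
Gromov's recognition of `(ℝ⁴, ω₀)` relative at infinity = SymplecticCap's staffed crux stmt-11009; engine E2 of
the triage, cards stretch-to-gromov ≈ cap-swap-gromov-end).  Hypotheses: crux data verbatim + `stub_sides` +
`stub_collar` outputs + the genus-0 branch of the pinch (`b₁(Sᵢ) = 0`, `b₂(Nᵢ) = 1`, `H₁(Nᵢ ∖ Bᵢ)`
torsion-free, `H₁(Vᵢ) = H₂(Vᵢ) = 0`) + Gromov rel end.  Conclusion: `M` is a twisted sphere,
`∃ φ, IsTwistedSphere 3 φ M`.  Proof route: `Sᵢ ≅ S²` (`b₁ = 0` + oriented by `bᵢ*sᵢ`), `Bᵢ·Bᵢ = +1`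
(`m = 1`, `b⁺ = 1`); symplectic neighbourhood theorem (MS2017 Thm 3.4.10) + `ℂP² ∖ line =` open ball
(MS2017 Ex. 4.3.4 (iv)/p.335): a neighbourhood of `Bᵢ` is symplectomorphic to one of the line, so the END of
`(Vᵢ, βᵢ*sᵢ) ≅ (Nᵢ ∖ Bᵢ, sᵢ)` is the OUTER shell `{r₁ < ‖ζ‖ < 1}` of a ball (`‖ζ‖ → 1` at `Z`); radial
stretch `h ↑ ∞` on the same carrier `Vᵢ` (`TopologicalSpace.Opens M`) gives the ten hypotheses of the fact
(`π₂(Vᵢ) = 0`: `H₁ = H₂ = 0` given, `π₁ = 1` by van Kampen from `π₁(M) = 1` and `Z ≅ S³`, Hurewicz);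
the RELATIVE clause returns `Dᵢ := Φᵢ⁻¹(closed ball) ⊂ Vᵢ`, a smoothly parametrised closed 4-disc whose
boundary is a level set of `q_E ∘ βᵢ` for the round tube function `q_E = (|z₀|²/|z|²) ∘ Ψᵢ` — so by the
COLLAR hypothesis (applied to `q_E`) the region between `∂D₀`, `Z` and `∂D₁` is a product `S³ × I`
(Fermi charts `F₀`, `F₁`; blend via `Literature/Topology/FourManifolds/BlendCollars`, `CollarShrink`,
`CollarAttachment`, `RadialExtension`, `BallGluingUniqueness`), whence two codimension-0 closed-disc
embeddings covering `M` and meeting along `S³` via some `φ` (`IsBoundaryGluing` of two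
`closedBallBoundaryData 3` = `IsTwistedSphere 3 φ M`).  `φ` is arbitrary (the two null fibrations of `Z`
need not agree — corank-one-collar's two-kernel remark), so Cerf is genuinely needed downstream.  Natural
reshape point if too big: split off `ShellEndStretch` (card stretch-to-gromov, elaborated in ideator 2's
Sketch) as its own stub.  Barriers: OpenAnalogue/ExoticContractible evaded — `Dᵢ` comes from the relative
clause, never from "`Vᵢ ≅ ℝ⁴` abstractly". [folklore] -/
theorem stub_genusZeroTwisted :
    ∀ (M : Type) [TopologicalSpace M] [T2Space M] [SecondCountableTopology M] [ChartedSpace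
      (EuclideanSpace ℝ (Fin 4)) M] [IsManifold (𝓡 4) ∞ M], M ≃ₕ Metric.sphere (0 : EuclideanSpace
      ℝ (Fin 5)) 1 → ∀ (V : Fin 2 → TopologicalSpace.Opens M) (N : Fin 2 → Type) [∀ i,
      TopologicalSpace (N i)] [∀ i, T2Space (N i)] [∀ i, SecondCountableTopology (N i)] [∀ i,
      CompactSpace (N i)] [∀ i, ConnectedSpace (N i)] [∀ i, ChartedSpace (EuclideanSpace ℝ (Fin 4))
      (N i)] [∀ i, IsManifold (𝓡 4) ∞ (N i)] (s : ∀ i, Literature.Geometry.Kaehler.MForm (𝓡 4) (N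
      i) ℝ 2) (S : Fin 2 → Type) [∀ i, TopologicalSpace (S i)] [∀ i, CompactSpace (S i)] [∀ i,
      ConnectedSpace (S i)] [∀ i, ChartedSpace (EuclideanSpace ℝ (Fin 2)) (S i)] [∀ i, IsManifold
      (𝓡 2) ∞ (S i)] (b : ∀ i, S i → N i) (β : ∀ i, M → N i) (Z : Type) [TopologicalSpace Z]
      [ChartedSpace (EuclideanSpace ℝ (Fin 3)) Z] [IsManifold (𝓡 3) ∞ Z] (z : Z → M), Disjoint (V
      0) (V 1) → (∀ i, (V i : Set M).Nonempty) → IsConnected ((V 0 : Set M) ∪ (V 1 : Set M))ᶜ →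
      Manifold.IsSmoothEmbedding (𝓡 3) (𝓡 4) ∞ z → Set.range z = ((V 0 : Set M) ∪ (V 1 : Set M))ᶜ →
      (∀ i, Literature.Geometry.Kaehler.IsSmoothForm (s i) ∧
      Literature.Geometry.Kaehler.IsClosedForm (s i) ∧ (∀ x (v : TangentSpace (𝓡 4) x), v ≠ 0 → ∃
      w, s i x ![v, w] ≠ 0) ∧ Manifold.IsSmoothEmbedding (𝓡 2) (𝓡 4) ∞ (b i) ∧ (∀ y (v :
      TangentSpace (𝓡 2) y), v ≠ 0 → ∃ w : TangentSpace (𝓡 2) y, s i (b i y) ![mfderiv (𝓡 2) (𝓡 4)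
      (b i) y v, mfderiv (𝓡 2) (𝓡 4) (b i) y w] ≠ 0) ∧ (∃ U : Set M, IsOpen U ∧ closure (V i : Set
      M) ⊆ U ∧ ContMDiffOn (𝓡 4) (𝓡 4) ∞ (β i) U) ∧ Set.InjOn (β i) (V i : Set M) ∧ β i '' (V i :
      Set M) = (Set.range (b i))ᶜ ∧ (∀ x ∈ (V i : Set M), Function.Bijective (mfderiv (𝓡 4) (𝓡 4)
      (β i) x)) ∧ β i '' frontier (V i : Set M) ⊆ Set.range (b i) ∧ (∀ x ∈ frontier (V i : Set M),
      Module.finrank ℝ (LinearMap.ker (mfderiv (𝓡 4) (𝓡 4) (β i) x).toLinearMap) = 1)) → (∀ i,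
      frontier (V i : Set M) = Set.range z ∧ interior (closure (V i : Set M)) = (V i : Set M)) → (∀
      (i : Fin 2) (q : N i → ℝ), (∀ p : S i, ∃ O : Set (N i), IsOpen O ∧ b i p ∈ O ∧ ∃ w : N i →
      EuclideanSpace ℝ (Fin 2), ContMDiffOn (𝓡 4) 𝓘(ℝ, EuclideanSpace ℝ (Fin 2)) ∞ w O ∧ (∀ y ∈ O,
      w y = 0 ↔ y ∈ Set.range (b i)) ∧ Function.Surjective (mfderiv (𝓡 4) 𝓘(ℝ, EuclideanSpace ℝ
      (Fin 2)) w (b i p)) ∧ ∀ y ∈ O, q y = ‖w y‖ ^ 2) → ∃ ε : ℝ, 0 < ε ∧ ∃ F : Z × ℝ → M,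
      ContMDiffOn ((𝓡 3).prod 𝓘(ℝ, ℝ)) (𝓡 4) ∞ F (Set.univ ×ˢ Set.Ioo (-ε) ε) ∧ Set.InjOn F
      (Set.univ ×ˢ Set.Ioo (-ε) ε) ∧ IsOpen (F '' (Set.univ ×ˢ Set.Ioo (-ε) ε)) ∧ (∀ x : Z × ℝ, x ∈
      Set.univ ×ˢ Set.Ioo (-ε) ε → Function.Bijective (mfderiv ((𝓡 3).prod 𝓘(ℝ, ℝ)) (𝓡 4) F x)) ∧
      (∀ p : Z, F (p, 0) = z p) ∧ (∀ (p : Z) (t : ℝ), t ∈ Set.Ioo (-ε) ε → (F (p, t) ∈ (V i : Set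
      M) ↔ 0 < t)) ∧ (∀ (p : Z) (t : ℝ), t ∈ Set.Ico 0 ε → q (β i (F (p, t))) = t ^ 2)) → (∀ i,
      Module.finrank ℤ (Literature.Topology.FourManifolds.singularHomologyZ (S i) 1) = 0 ∧
      Module.finrank ℤ (Literature.Topology.FourManifolds.singularHomologyZ (N i) 2) = 1 ∧
      NoZeroSMulDivisors ℤ (Literature.Topology.FourManifolds.singularHomologyZ (↥((Set.range (b
      i))ᶜ)) 1) ∧ Subsingleton (Literature.Topology.FourManifolds.singularHomologyZ (V i) 1) ∧
      Subsingleton (Literature.Topology.FourManifolds.singularHomologyZ (V i) 2)) →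
      Literature.Geometry.Symplectic.gromov_recognitionR4_relEnd → ∃ φ : (Metric.sphere (0 :
      EuclideanSpace ℝ (Fin 4)) 1) ≃ₘ⟮𝓡 3, 𝓡 3⟯ (Metric.sphere (0 : EuclideanSpace ℝ (Fin 4)) 1),
      Literature.Topology.FourManifolds.IsTwistedSphere 3 φ M := by
  sorry

/-! ## §3 Name-keyed aliases of the five statements (the hypotheses of `OrigamiRung_of`; the native skeleton
audit admits a `Prop` hypothesis whose head constant's last name component is a declared stub) -/
namespace Registered

/-- Alias of `SidesStatement` keyed by the registered stub name. -/
abbrev stub_sides : Prop := SidesStatement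
/-- Alias of `CollarStatement` keyed by the registered stub name. -/
abbrev stub_collar : Prop := CollarStatement
/-- Alias of `PinchStatement` keyed by the registered stub name. -/
abbrev stub_pinch : Prop := PinchStatement
/-- Alias of `ChernStatement` keyed by the registered stub name. -/
abbrev stub_chern : Prop := ChernStatement
/-- Alias of `GenusZeroTwistedStatement` keyed by the registered stub name. -/
abbrev stub_genusZeroTwisted : Prop := GenusZeroTwistedStatement

end Registered

/-! ## §4 Proved glue: the arithmetic of the sieve -/

/-- **Sieve arithmetic** (kernel-checked; supersedes `Negative.genusTable`, no `K`-sign and no Liu Thm A):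
with `x = b₁(S₀) = b₁(S₁)` (`= 2g`), `aᵢ = b₁(Nᵢ)`, the Chern package `(3 − x)² = 9 − 4aᵢ` on both pieces
and the pinch `a₀ + a₁ = x` leave exactly `g = 0` with `a₀ = a₁ = 0`, or `g = 2` with `a₀ = a₁ = 2` (the
door). [folklore] -/
theorem sieve_arith_nat (x a₀ a₁ : ℕ) (h₀ : ((3 : ℤ) - (x : ℤ)) ^ 2 = 9 - 4 * (a₀ : ℤ))
    (h₁ : ((3 : ℤ) - (x : ℤ)) ^ 2 = 9 - 4 * (a₁ : ℤ)) (hs : a₀ + a₁ = x) :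
    (x = 0 ∧ a₀ = 0 ∧ a₁ = 0) ∨ (x = 4 ∧ a₀ = 2 ∧ a₁ = 2) := by
  have hlin : (9 : ℤ) - 4 * (a₀ : ℤ) = 9 - 4 * (a₁ : ℤ) := h₀.symm.trans h₁
  have hsq : (0 : ℤ) ≤ 9 - 4 * (a₀ : ℤ) := by rw [← h₀]; exact sq_nonneg _
  have hb : a₀ ≤ 2 := by omega
  have ha : a₀ = a₁ := by omega
  have hx : x = 2 * a₀ := by omega
  subst ha
  subst hx
  interval_cases a₀
  · omega
  · exfalso; norm_num at h₀
  · omega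

/-! ## §5 The composition: the five stubs (+ the two tagged sibling-route items Gromov rel end and Cerf)
imply the crux, BY NAME (kernel-checked; no `sorry` below this line) -/

open Literature.Topology.FourManifolds (singularHomologyZ)

/-- **`OrigamiRung_of`** — the glue of the line.  Sides (stub 1) feed the collar (stub 2, instantiated on
each piece and every round tube function); sides + collar feed the pinch (stub 3); the pinch's
`b₂(Nᵢ) = 1` and torsion-freeness feed the Chern package (stub 4) on each piece; `sieve_arith_nat` leaves
`g ∈ {0, 2}`; `g = 2` is the door disjunct verbatim; `g = 0` feeds the endgame (stub 5) under
`GromovRecognitionRelEnd` (SymplecticCap's crux, stmt-11009, verbatim the Literature named fact), whose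
twisted sphere Cerf's `Γ₄ = 0` (SchoenfliesSplit's item `SchsplitCerf`, stmt-8758, verbatim
`cerf_twistedSphere_four`) identifies with `S⁴`.  Compactness of `M` is the PROVED tree theorem
`compactSpace_of_homotopyEquiv_sphere_four_holds`. -/
theorem OrigamiRung_of (h₁ : Registered.stub_sides) (h₂ : Registered.stub_collar)
    (h₃ : Registered.stub_pinch) (h₄ : Registered.stub_chern) (h₅ : Registered.stub_genusZeroTwisted)
    (hG : Summit.SmoothPoincare4.SmoothPoincare4.Theses.SymplecticCap.GromovRecognitionRelEnd)
    (hC : Summit.SmoothPoincare4.SmoothPoincare4.Theses.SchoenfliesSplit.SchsplitCerf) :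
    Summit.SmoothPoincare4.SmoothPoincare4.Theses.SymplecticOrigami.OrigamiRung := by
  intro M _ _ _ _ _ e V N _ _ _ _ _ _ _ s S _ _ _ _ _ b β hdata hprops
  haveI : CompactSpace M :=
    Literature.Topology.FourManifolds.compactSpace_of_homotopyEquiv_sphere_four_holds M e
  obtain ⟨hdisj, hne, hconn, Z, _tZ, _cZ, _mZ, z, hz, hrange⟩ := hdata
  -- stub 1: sides
  have hS : ∀ i, frontier (V i : Set M) = Set.range z ∧ interior (closure (V i : Set M)) = (V i : Set M) :=
    h₁ M e V Z z hdisj hne hconn hz hrange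
  -- stub 2: the collar, on each piece and for every round tube function
  have hK : ∀ (i : Fin 2) (q : N i → ℝ), IsRoundTubeFn (b i) q →
      HasPullbackCollar (V i : Set M) (β i) q z := by
    intro i q hq
    obtain ⟨-, -, -, hb, -, hU, -, -, -, hfr, hker⟩ := hprops i
    exact h₂ M (V i) (N i) (S i) (b i) (β i) q Z z hz (hS i).1.symm (hS i).2 hb hU hfr hker hq
  -- stub 3: the pinch
  obtain ⟨hP, hsum, hSS⟩ := h₃ M e V N s S b β Z z hdisj hne hconn hz hrange hprops hS hK
  -- stub 4: the Chern package on each piece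
  have hCh : ∀ i, ((3 : ℤ) - (Module.finrank ℤ (singularHomologyZ (S i) 1) : ℤ)) ^ 2 =
      9 - 4 * (Module.finrank ℤ (singularHomologyZ (N i) 1) : ℤ) := by
    intro i
    obtain ⟨h1, h2, h3, h4, h5, -⟩ := hprops i
    exact h₄ (N i) (s i) (S i) (b i) h1 h2 h3 h4 h5 (hP i).1 (hP i).2.1
  -- arithmetic of the sieve
  have h1' : ((3 : ℤ) - (Module.finrank ℤ (singularHomologyZ (S 0) 1) : ℤ)) ^ 2 =
      9 - 4 * (Module.finrank ℤ (singularHomologyZ (N 1) 1) : ℤ) := by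
    have h := hCh 1
    rwa [← hSS] at h
  rcases sieve_arith_nat _ _ _ (hCh 0) h1' hsum with ⟨hx, ha₀, ha₁⟩ | ⟨hx, ha₀, ha₁⟩
  · -- genus 0: both collapsed folds are spheres, both pieces homology (ℂP², line)'s — the endgame
    have hg : ∀ i, Module.finrank ℤ (singularHomologyZ (S i) 1) = 0 :=
      Fin.forall_fin_two.mpr ⟨hx, hSS ▸ hx⟩
    have hdat : ∀ i, Module.finrank ℤ (singularHomologyZ (S i) 1) = 0 ∧
        Module.finrank ℤ (singularHomologyZ (N i) 2) = 1 ∧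
        NoZeroSMulDivisors ℤ (singularHomologyZ (↥((Set.range (b i))ᶜ)) 1) ∧
        Subsingleton (singularHomologyZ (V i) 1) ∧ Subsingleton (singularHomologyZ (V i) 2) :=
      fun i => ⟨hg i, (hP i).1, (hP i).2.1, ((hP i).2.2 (hg i)).1, ((hP i).2.2 (hg i)).2⟩
    obtain ⟨φ, hφ⟩ := h₅ M e V N s S b β Z z hdisj hne hconn hz hrange hprops hS hK hdat hG
    exact Or.inl
      (Literature.Topology.FourManifolds.nonempty_diffeomorph_sphere_four_of_isTwistedSphere_of_cerf hC hφ)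
  · -- genus 2: both pieces are doors
    exact Or.inr (Fin.forall_fin_two.mpr ⟨⟨ha₀, (hP 0).1⟩, ⟨ha₁, (hP 1).1⟩⟩)

/-- Wiring check: the registered (inlined) stubs feed `OrigamiRung_of` as stated — each inlined restatement
is definitionally the named statement of §1. -/
example (hG : Summit.SmoothPoincare4.SmoothPoincare4.Theses.SymplecticCap.GromovRecognitionRelEnd)
    (hC : Summit.SmoothPoincare4.SmoothPoincare4.Theses.SchoenfliesSplit.SchsplitCerf) :
    Summit.SmoothPoincare4.SmoothPoincare4.Theses.SymplecticOrigami.OrigamiRung :=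
  OrigamiRung_of stub_sides stub_collar stub_pinch stub_chern stub_genusZeroTwisted hG hC

/-- Consistency of the two fact-items with the Literature named facts they transcribe (definitional). -/
example : Summit.SmoothPoincare4.SmoothPoincare4.Theses.SymplecticCap.GromovRecognitionRelEnd ↔
    Literature.Geometry.Symplectic.gromov_recognitionR4_relEnd := Iff.rfl

example : Summit.SmoothPoincare4.SmoothPoincare4.Theses.SchoenfliesSplit.SchsplitCerf ↔
    Literature.Topology.FourManifolds.cerf_twistedSphere_four := Iff.rfl

end Summit.SmoothPoincare4.SmoothPoincare4.Cruxes.OrigamiRung.RoundTubePullbackCollar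

end
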